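import Mathlib
import Summits.Schanuel.Schanuel.Theses.RigidCore
import Summits.Schanuel.Schanuel.Theorems.MinimalCounterexampleInAcl.Negative.LocusMates
import Summits.Schanuel.Schanuel.Theorems.MinimalCounterexampleInAcl.Negative.IsolationFree
import Summits.Schanuel.Schanuel.Theorems.RigidCoreMinimalCounterexampleInAclSpanGrowthStubsT1I
import Summits.Schanuel.Schanuel.Theorems.RigidCoreMinimalCounterexampleInAclSpanGrowthStep
import Literature.NumberTheory.Transcendental.GammaFields

/-!
# Crux `RigidCore.MinimalCounterexampleInAcl` (stmt-Schanuel-0969), line `span-growth-dichotomy`: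
the dichotomy, and what the line prices (S*) at (lead c17)

With the registered stubs T1 `stub_matePredim`, T2 `stub_spanGrowthStep`, I `stub_isolationFree` landed
(Theorems/…SpanGrowthStubsT1I p161753, …SpanGrowthStep p162065), the sorry-free glue of the skeleton
`Cruxes/MinimalCounterexampleInAcl/Lines/span-growth-dichotomy.lean` becomes a set of tree theorems about an
arbitrary first-failure counterexample `x` to Schanuel's conjecture (`x` ℚ-linearly independent of rank `n`,
`trdeg ℚ(x, eˣ) < n`, Schanuel in all ranks `< n`) and its locus mates (`Negative.locusMates x`); no new
definition is introduced (the "mate coordinates" are written `⋃ x' ∈ locusMates x, range x'`, a "tower of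
depth `k`" is the proposition `∃ G, ↑G ⊆ ⋃ … ∧ δ(span(x ∪ G)) ≤ −(k+1)`):

* `span_growth_dichotomy` — EITHER the predimension `δ(span_ℚ(x ∪ G))` is unbounded below along finite sets
  `G` of mate coordinates ("Schanuel fails infinitely badly inside one ℚ-locus") OR all mates lie in ONE
  finite-dimensional ℚ-space;
* `locusDefectBounded_iff_rank_bounded` — the line's residual stub D (bounded defect along the mate span) is
  EQUIVALENT, at each first failure, to bounded ℚ-rank of the mate family;
* `residues_iff_firstFailureSparsity` — the line's two open stubs together, D ∧ M (M = the finite-rank case: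
  mates confined to one finitely generated ℚ-space are finitely many), are EQUIVALENT to first-failure
  sparsity "every first failure has finitely many locus mates";
* `minimalCounterexampleInAcl_of_residues` — hence (S*) from D ∧ M (definable isolation is free, Stub I).

So the line prices (S*) at exactly first-failure SPARSITY (mate finiteness), which at rank 2 is the sibling
crux `SparsityTwo` on first-failure curves and which the sibling line `kernel-arithmetic-selection` has shown to
be MORE than (S*) needs (acl-membership without finiteness on the mixed, gadget-algebraic and corank-one
sectors).  Recorded for the planners; see `Cruxes/MinimalCounterexampleInAcl/Lines/span-growth-dichotomy.dead.md`.

## References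

* M. Bays, J. Kirby, *Pseudo-exponential maps, variants, and quasiminimality*, Algebra & Number Theory 12
  (2018), arXiv:1512.04262, Def. 4.1, Lemma 4.2 (predimension, submodularity), §9.2 (bounded defect).
* J. Kirby, *Exponential algebraicity in exponential fields*, Bull. LMS 42 (2010), arXiv:0810.4285, Prop. 7.2.
-/

noncomputable section

set_option linter.dupNamespace false

open Complex Set
open Literature.NumberTheory.Transcendental
open Literature.ModelTheory.ExponentialFields
open Summit.Schanuel.Schanuel.Theorems.MinimalCounterexampleInAcl.Negative

namespace Summit.Schanuel.Schanuel.Cruxes.MinimalCounterexampleInAcl.SpanGrowthDichotomy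

variable {n : ℕ}

/-! ## Two bookkeeping lemmas -/

/-- The coordinates of a mate are mate coordinates. -/
theorem range_subset_iUnion_mates {x x' : Fin n → ℂ} (hx' : x' ∈ locusMates x) :
    range x' ⊆ ⋃ y ∈ locusMates x, range y :=
  Set.subset_biUnion_of_mem (u := fun y : Fin n → ℂ => range y) hx'

/-- A predicate on `ℕ` that holds at `0` and fails at some `d` has a LAST point where it holds. -/
theorem exists_last_of_not {P : ℕ → Prop} (h0 : P 0) {d : ℕ} (hd : ¬ P d) :
    ∃ k, P k ∧ ¬ P (k + 1) := by
  by_contra h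
  push Not at h
  have hall : ∀ k, P k := by
    intro k
    induction k with
    | zero => exact h0
    | succ k ih => exact h k ih
  exact hd (hall d)

/-! ## The tower (T1 at depth 0, T2 for the successor step) -/

section FirstFailure

variable {x : Fin n → ℂ}
  (hx : LinearIndependent ℚ x ∧
    Algebra.trdeg ℚ ↥(IntermediateField.adjoin ℚ (range x ∪ range (cexp ∘ x))) < (n : Cardinal) ∧
    ∀ r < n, SchanuelRank r)
include hx

/-- Depth `0`: `δ(span x) ≤ −1` (Stub T1 at `x' = x`), i.e. a tower of depth `0` with `G = ∅`. -/
theorem tower_zero :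
    ∃ G : Finset ℂ, (G : Set ℂ) ⊆ (⋃ y ∈ locusMates x, range y) ∧
      GammaField.predim (⊥ : Submodule ℚ ℂ) (Submodule.span ℚ (range x ∪ (G : Set ℂ))) ≤ -(((0 : ℕ) : ℤ) + 1) := by
  refine ⟨∅, by simp, ?_⟩
  simpa using stub_matePredim hx (x' := x) (self_mem_locusMates hx.1)

/-- The tower grows: a mate OUTSIDE `span(x ∪ G)` deepens a depth-`k` tower to depth `k + 1` (Stub T2 fed by
Stub T1: `δ(span(x ∪ G) + span x') ≤ δ(span(x ∪ G)) − 1`). -/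
theorem tower_succ_of_new {k : ℕ} {G : Finset ℂ} (hG : (G : Set ℂ) ⊆ ⋃ y ∈ locusMates x, range y)
    (hGδ : GammaField.predim (⊥ : Submodule ℚ ℂ) (Submodule.span ℚ (range x ∪ (G : Set ℂ))) ≤ -((k : ℤ) + 1))
    {x' : Fin n → ℂ} (hx' : x' ∈ locusMates x)
    (hnew : ¬ (range x' ⊆ (Submodule.span ℚ (range x ∪ (G : Set ℂ)) : Set ℂ))) :
    ∃ G' : Finset ℂ, (G' : Set ℂ) ⊆ (⋃ y ∈ locusMates x, range y) ∧
      GammaField.predim (⊥ : Submodule ℚ ℂ) (Submodule.span ℚ (range x ∪ (G' : Set ℂ))) ≤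
        -(((k + 1 : ℕ) : ℤ) + 1) := by
  classical
  refine ⟨G ∪ Finset.univ.image x', ?_, ?_⟩
  · rw [Finset.coe_union]
    refine Set.union_subset hG ?_
    rw [Finset.coe_image, Finset.coe_univ, Set.image_univ]
    exact range_subset_iUnion_mates hx'
  · have hS : (Submodule.span ℚ (range x ∪ (G : Set ℂ))).FG :=
      Submodule.fg_span ((Set.finite_range x).union G.finite_toSet)
    have hstep := stub_spanGrowthStep hx.2.2 hx'.1 (stub_matePredim hx hx') _ hS hnew
    have hspan : Submodule.span ℚ (range x ∪ ((G ∪ Finset.univ.image x' : Finset ℂ) : Set ℂ)) =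
        Submodule.span ℚ (range x ∪ (G : Set ℂ)) ⊔ Submodule.span ℚ (range x') := by
      rw [Finset.coe_union, Finset.coe_image, Finset.coe_univ, Set.image_univ, ← Set.union_assoc,
        Submodule.span_union]
    rw [hspan]
    push_cast
    linarith

/-- At a LAST depth every mate is inside the tower's span: bounded ℚ-rank of the mate family. -/
theorem rank_bounded_of_last_depth {k : ℕ}
    (hk : ∃ G : Finset ℂ, (G : Set ℂ) ⊆ (⋃ y ∈ locusMates x, range y) ∧
      GammaField.predim (⊥ : Submodule ℚ ℂ) (Submodule.span ℚ (range x ∪ (G : Set ℂ))) ≤ -((k : ℤ) + 1))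
    (hk' : ¬ ∃ G : Finset ℂ, (G : Set ℂ) ⊆ (⋃ y ∈ locusMates x, range y) ∧
      GammaField.predim (⊥ : Submodule ℚ ℂ) (Submodule.span ℚ (range x ∪ (G : Set ℂ))) ≤
        -(((k + 1 : ℕ) : ℤ) + 1)) :
    ∃ s : Finset ℂ, ∀ x' ∈ locusMates x, range x' ⊆ (Submodule.span ℚ (s : Set ℂ) : Set ℂ) := by
  classical
  obtain ⟨G, hG, hGδ⟩ := hk
  refine ⟨Finset.univ.image x ∪ G, fun x' hx' => ?_⟩
  have hcoe : ((Finset.univ.image x ∪ G : Finset ℂ) : Set ℂ) = range x ∪ (G : Set ℂ) := by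
    rw [Finset.coe_union, Finset.coe_image, Finset.coe_univ, Set.image_univ]
  rw [hcoe]
  by_contra hnew
  exact hk' (tower_succ_of_new hx hG hGδ hx' hnew)

/-! ## The dichotomy; D ⟺ bounded rank -/

/-- **THE SPAN-GROWTH DICHOTOMY** (unconditional, from T1 + T2): along the mate family of a first-failure locus,
EITHER the predimension is unbounded below (towers of every depth: "Schanuel fails infinitely badly inside one
ℚ-locus") OR all mates lie in one finite-dimensional ℚ-space (the finite-rank case). -/
theorem span_growth_dichotomy :
    (∀ k : ℕ, ∃ G : Finset ℂ, (G : Set ℂ) ⊆ (⋃ y ∈ locusMates x, range y) ∧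
        GammaField.predim (⊥ : Submodule ℚ ℂ) (Submodule.span ℚ (range x ∪ (G : Set ℂ))) ≤ -((k : ℤ) + 1)) ∨
      ∃ s : Finset ℂ, ∀ x' ∈ locusMates x, range x' ⊆ (Submodule.span ℚ (s : Set ℂ) : Set ℂ) := by
  by_cases h : ∀ k : ℕ, ∃ G : Finset ℂ, (G : Set ℂ) ⊆ (⋃ y ∈ locusMates x, range y) ∧
      GammaField.predim (⊥ : Submodule ℚ ℂ) (Submodule.span ℚ (range x ∪ (G : Set ℂ))) ≤ -((k : ℤ) + 1)
  · exact Or.inl h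
  · right
    push Not at h
    obtain ⟨d, hd⟩ := h
    obtain ⟨k, hk, hk'⟩ := exists_last_of_not
      (P := fun k : ℕ => ∃ G : Finset ℂ, (G : Set ℂ) ⊆ (⋃ y ∈ locusMates x, range y) ∧
        GammaField.predim (⊥ : Submodule ℚ ℂ) (Submodule.span ℚ (range x ∪ (G : Set ℂ))) ≤ -((k : ℤ) + 1))
      (tower_zero hx) (d := d) (by
        rintro ⟨G, hG, hGδ⟩
        have h := hd G hG
        linarith)
    exact rank_bounded_of_last_depth hx hk hk'

/-- **Stub D ⟺ BOUNDED ℚ-RANK OF THE MATE FAMILY** (unconditional, from T1 + T2): the line's residual stub —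
`δ(span_ℚ(x ∪ G)) ≥ −d` for all finite sets `G` of mate coordinates — holds at a first failure `x` iff all locus
mates of `x` lie in one finitely generated ℚ-space.  (`→`: a bound `−d` forbids towers of depth `d`, so the
tower has a last depth; `←`: `δ(V) = td(V) − dim V ≥ −dim V ≥ −|s|` for `V ≤ span s`.) -/
theorem locusDefectBounded_iff_rank_bounded :
    (∃ d : ℕ, ∀ G : Finset ℂ, (G : Set ℂ) ⊆ (⋃ y ∈ locusMates x, range y) →
        -(d : ℤ) ≤ GammaField.predim (⊥ : Submodule ℚ ℂ) (Submodule.span ℚ (range x ∪ (G : Set ℂ)))) ↔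
      ∃ s : Finset ℂ, ∀ x' ∈ locusMates x, range x' ⊆ (Submodule.span ℚ (s : Set ℂ) : Set ℂ) := by
  constructor
  · rintro ⟨d, hd⟩
    obtain ⟨k, hk, hk'⟩ := exists_last_of_not
      (P := fun k : ℕ => ∃ G : Finset ℂ, (G : Set ℂ) ⊆ (⋃ y ∈ locusMates x, range y) ∧
        GammaField.predim (⊥ : Submodule ℚ ℂ) (Submodule.span ℚ (range x ∪ (G : Set ℂ))) ≤ -((k : ℤ) + 1))
      (tower_zero hx) (d := d) (by
        rintro ⟨G, hG, hGδ⟩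
        have h := hd G hG
        linarith)
    exact rank_bounded_of_last_depth hx hk hk'
  · rintro ⟨s, hs⟩
    refine ⟨s.card, fun G hG => ?_⟩
    have hle : Submodule.span ℚ (range x ∪ (G : Set ℂ)) ≤ Submodule.span ℚ (s : Set ℂ) := by
      refine Submodule.span_le.2 (Set.union_subset (hs x (self_mem_locusMates hx.1)) fun c hc => ?_)
      obtain ⟨x', hx', hc'⟩ : ∃ x' ∈ locusMates x, c ∈ range x' := by simpa using hG hc
      exact hs x' hx' hc'
    have h1 : GammaField.ldim (⊥ : Submodule ℚ ℂ) (Submodule.span ℚ (range x ∪ (G : Set ℂ))) ≤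
        GammaField.ldim (⊥ : Submodule ℚ ℂ) (Submodule.span ℚ (s : Set ℂ)) :=
      GammaField.ldim_mono (GammaField.isFG_span_finset ⊥ s) hle
    have h2 : GammaField.ldim (⊥ : Submodule ℚ ℂ) (Submodule.span ℚ (s : Set ℂ)) ≤ s.card :=
      GammaField.ldim_span_le_card ⊥ s
    rw [GammaField.predim_def]
    omega

end FirstFailure

/-! ## What the line prices (S*) at: D ∧ M ⟺ first-failure sparsity -/

/-- **THE LINE'S TWO OPEN STUBS ARE JOINTLY FIRST-FAILURE SPARSITY.**  Stub D (bounded defect along the mate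
span, for every first failure) together with Stub M (the finite-rank case: mates confined to one finitely
generated ℚ-space are finitely many) is EQUIVALENT to "every first-failure counterexample to Schanuel has only
finitely many locus mates" — the hypothesis of `Negative.minimalCounterexampleInAcl_of_firstFailureSparsity`.
(`→`: D gives bounded rank (`locusDefectBounded_iff_rank_bounded`), then M; `←`: a finite mate set has
bounded rank, hence D, and M is immediate.)  The two conjuncts on the left are VERBATIM the registered stubs
`stub_locusDefectBounded` and `stub_finiteRankCase` of the skeleton. -/
theorem residues_iff_firstFailureSparsity :
    ((∀ {n : ℕ} {x : Fin n → ℂ},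
        (LinearIndependent ℚ x ∧
          Algebra.trdeg ℚ ↥(IntermediateField.adjoin ℚ (Set.range x ∪ Set.range (Complex.exp ∘ x))) <
            (n : Cardinal) ∧
          ∀ r < n, Literature.NumberTheory.Transcendental.SchanuelRank r) →
        ∃ d : ℕ, ∀ G : Finset ℂ,
          (G : Set ℂ) ⊆ (⋃ x' ∈ {x' : Fin n → ℂ | LinearIndependent ℚ x' ∧
            ∀ p : MvPolynomial (Fin n ⊕ Fin n) ℚ,
              MvPolynomial.aeval (Sum.elim x (Complex.exp ∘ x)) p = 0 →
                MvPolynomial.aeval (Sum.elim x' (Complex.exp ∘ x')) p = 0}, Set.range x') →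
          -(d : ℤ) ≤ Literature.NumberTheory.Transcendental.GammaField.predim (⊥ : Submodule ℚ ℂ)
            (Submodule.span ℚ (Set.range x ∪ (G : Set ℂ)))) ∧
      (∀ {n : ℕ} {x : Fin n → ℂ},
        (LinearIndependent ℚ x ∧
          Algebra.trdeg ℚ ↥(IntermediateField.adjoin ℚ (Set.range x ∪ Set.range (Complex.exp ∘ x))) <
            (n : Cardinal) ∧
          ∀ r < n, Literature.NumberTheory.Transcendental.SchanuelRank r) →
        ∀ s : Finset ℂ,
          (∀ x' : Fin n → ℂ,
            (LinearIndependent ℚ x' ∧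
            ∀ p : MvPolynomial (Fin n ⊕ Fin n) ℚ,
              MvPolynomial.aeval (Sum.elim x (Complex.exp ∘ x)) p = 0 →
                MvPolynomial.aeval (Sum.elim x' (Complex.exp ∘ x')) p = 0) →
            Set.range x' ⊆ (Submodule.span ℚ (s : Set ℂ) : Set ℂ)) →
          Set.Finite {x' : Fin n → ℂ | LinearIndependent ℚ x' ∧
            ∀ p : MvPolynomial (Fin n ⊕ Fin n) ℚ,
              MvPolynomial.aeval (Sum.elim x (Complex.exp ∘ x)) p = 0 →
                MvPolynomial.aeval (Sum.elim x' (Complex.exp ∘ x')) p = 0})) ↔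
    ∀ {n : ℕ} {x : Fin n → ℂ},
      (LinearIndependent ℚ x ∧
        Algebra.trdeg ℚ ↥(IntermediateField.adjoin ℚ (Set.range x ∪ Set.range (Complex.exp ∘ x))) <
          (n : Cardinal) ∧
        ∀ r < n, Literature.NumberTheory.Transcendental.SchanuelRank r) →
      (Summit.Schanuel.Schanuel.Theorems.MinimalCounterexampleInAcl.Negative.locusMates x).Finite := by
  constructor
  · rintro ⟨hD, hM⟩ n x hx
    obtain ⟨s, hs⟩ := (locusDefectBounded_iff_rank_bounded hx).1 (hD hx)
    exact hM hx s fun x' hx' => hs x' hx'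
  · intro hF
    refine ⟨fun {n} {x} hx => ?_, fun {n} {x} hx s _ => hF hx⟩
    classical
    have hfin := hF hx
    refine (locusDefectBounded_iff_rank_bounded hx).2
      ⟨hfin.toFinset.biUnion fun x' => Finset.univ.image x', ?_⟩
    intro x' hx' c hc
    refine Submodule.subset_span ?_
    rw [Finset.coe_biUnion]
    refine Set.mem_iUnion₂.2 ⟨x', hfin.mem_toFinset.2 hx', ?_⟩
    rw [Finset.coe_image, Finset.coe_univ, Set.image_univ]
    exact hc

/-- **(S*) FROM THE LINE'S TWO OPEN STUBS** (the composition of the skeleton, as an implication between tree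
statements): bounded defect along mate spans (D) and the finite-rank case (M) give first-failure sparsity, and
definable isolation is free (`Negative.minimalCounterexampleInAcl_of_firstFailureSparsity`). -/
theorem minimalCounterexampleInAcl_of_residues
    (hD : ∀ {n : ℕ} {x : Fin n → ℂ},
        (LinearIndependent ℚ x ∧
          Algebra.trdeg ℚ ↥(IntermediateField.adjoin ℚ (Set.range x ∪ Set.range (Complex.exp ∘ x))) <
            (n : Cardinal) ∧
          ∀ r < n, Literature.NumberTheory.Transcendental.SchanuelRank r) →
        ∃ d : ℕ, ∀ G : Finset ℂ,
          (G : Set ℂ) ⊆ (⋃ x' ∈ {x' : Fin n → ℂ | LinearIndependent ℚ x' ∧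
            ∀ p : MvPolynomial (Fin n ⊕ Fin n) ℚ,
              MvPolynomial.aeval (Sum.elim x (Complex.exp ∘ x)) p = 0 →
                MvPolynomial.aeval (Sum.elim x' (Complex.exp ∘ x')) p = 0}, Set.range x') →
          -(d : ℤ) ≤ Literature.NumberTheory.Transcendental.GammaField.predim (⊥ : Submodule ℚ ℂ)
            (Submodule.span ℚ (Set.range x ∪ (G : Set ℂ))))
    (hM : ∀ {n : ℕ} {x : Fin n → ℂ},
        (LinearIndependent ℚ x ∧
          Algebra.trdeg ℚ ↥(IntermediateField.adjoin ℚ (Set.range x ∪ Set.range (Complex.exp ∘ x))) <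
            (n : Cardinal) ∧
          ∀ r < n, Literature.NumberTheory.Transcendental.SchanuelRank r) →
        ∀ s : Finset ℂ,
          (∀ x' : Fin n → ℂ,
            (LinearIndependent ℚ x' ∧
            ∀ p : MvPolynomial (Fin n ⊕ Fin n) ℚ,
              MvPolynomial.aeval (Sum.elim x (Complex.exp ∘ x)) p = 0 →
                MvPolynomial.aeval (Sum.elim x' (Complex.exp ∘ x')) p = 0) →
            Set.range x' ⊆ (Submodule.span ℚ (s : Set ℂ) : Set ℂ)) →
          Set.Finite {x' : Fin n → ℂ | LinearIndependent ℚ x' ∧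
            ∀ p : MvPolynomial (Fin n ⊕ Fin n) ℚ,
              MvPolynomial.aeval (Sum.elim x (Complex.exp ∘ x)) p = 0 →
                MvPolynomial.aeval (Sum.elim x' (Complex.exp ∘ x')) p = 0}) :
    Summit.Schanuel.Schanuel.Theses.RigidCore.MinimalCounterexampleInAcl :=
  minimalCounterexampleInAcl_of_firstFailureSparsity fun _ _ hli htr hrank =>
    residues_iff_firstFailureSparsity.1 ⟨hD, hM⟩ ⟨hli, htr, hrank⟩

end Summit.Schanuel.Schanuel.Cruxes.MinimalCounterexampleInAcl.SpanGrowthDichotomy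

end
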